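import Literature.Computability.Complexity.StackArith
import Mathlib.Algebra.Polynomial.Eval.Degree
import Mathlib.Data.Nat.Log
import HarnessLib

/-!
# Verified unary arithmetic on stack programs: counters, Horner evaluation of polynomials, logarithm

Trunk `CplxCore`, toolkit for `TimeBounds.lean`, continuing `StackPrograms.lean` / `StackArith.lean`
(binary arithmetic) with the **unary** register discipline used by clock- and length-computations:
a register holding `1ᵏ` (`Literature.CplxCore.ones k` of `UnaryArithMachines.lean`) is a counter, and all quantities of a polynomial-time length
computation (`|x|`, `p(|x|)`, `⌊log₂ |x|⌋`, quotients and differences of such) fit in unary within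
the time bound. Every program is generic over the register type `ι`, takes its registers as
parameters (pairwise distinct), and comes with an exact functional effect stated with
`Function.update` and an explicit step bound (`Com.Runs`), in the style of `Com.runs_pour` /
`Com.runs_copy`:

* counters: `popK` (`k := k ⇂ m`), `pushK` (`k := 1ᵐ ++ k`), `subFrom x y` (truncated
  subtraction `x := x ⇂ |y|`), `addReg p v t` (`v` gains `|p|` units, `p` kept), `dblReg p t`
  (`p := 1^{2|p|}`);
* data movement under a counter: `takeN q s d` (move `|q|` symbols from `s` onto `d`),
  `pourDbl k o` (pour `k` onto `o` doubling every bit — the first component of a `boolPair`);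
* **Horner evaluation** `hornerProg n a a2 t cs` of an `ℕ`-polynomial given by its coefficient
  list (`coeffsHL Q`, highest first) at the unary value of register `n`, result in unary in `a`
  (`runs_evalPoly`: `a := 1^{Q(N)}` in `(deg Q + 1) · (Q(N+1) · (10 N + 5) + 2)` steps, with the
  arithmetic `hornerVal_coeffsHL : hornerVal N 0 (coeffsHL Q) = Q.eval N`; note
  `hornerVal N 0 cs = Nat.ofDigits N cs.reverse`);
* **binary logarithm** by repeated halving with fuel: `logCount f v a d` adds `⌊log₂ |v|⌋` units to
  `d` (`runs_logCount`, `logC_snd`; `Nat.log_div_base`).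

The Horner arithmetic (`hornerVal` … `mem_coeffsHL`) and the counters `popK`/`pushK`/`subFrom` were
first written register-specifically in `Cryptography/LiuPassDistProgram.lean` (`LPD.*`); that file
is to be refactored onto this generic one (follow-up: import `StackUnary`, delete the `LPD` copies).

## References

* S. Arora, B. Barak, *Computational Complexity: A Modern Approach*, CUP 2009, §1.3 (polynomial
  time is robust; counters and arithmetic on work tapes), §3.1 (time-constructible functions).
* T. Nipkow, G. Klein, *Concrete Semantics*, Springer 2014, Ch. 7–8 (big-step verification style).
* D. E. Knuth, *The Art of Computer Programming*, Vol. 2, 3rd ed., §4.6.4 (Horner's rule).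
-/

namespace Literature.Computability.Complexity

open _root_.Computability

namespace Com

section Generic

variable {ι : Type} [DecidableEq ι]

/-! ### Unary register contents: `ones n = 1ⁿ` (`UnaryArithMachines.lean`) -/

/-- `1ⁿ⁺¹ = 1 :: 1ⁿ`. [folklore] -/
theorem ones_succ (n : ℕ) : ones (n + 1) = true :: ones n := rfl

/-- `1ᵐ ++ 1ⁿ = 1ᵐ⁺ⁿ`. [folklore] -/
theorem ones_append (m n : ℕ) : ones m ++ ones n = ones (m + n) := by simp [ones]

/-- `1ⁿ ⇂ m = 1ⁿ⁻ᵐ`. [folklore] -/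
theorem drop_ones (n m : ℕ) : (ones n).drop m = ones (n - m) := by simp [ones, List.drop_replicate]

/-- The bit doubling `SProg.dbl` (`StackMachines.lean`) of a unary word. [folklore] -/
theorem dbl_ones (n : ℕ) : SProg.dbl (ones n) = ones (2 * n) := by
  induction n with
  | zero => rfl
  | succ n ih => rw [ones_succ, SProg.dbl_cons, ih, show 2 * (n + 1) = 2 * n + 1 + 1 by ring]; rfl

/-! ### Counters -/

/-- One guarded pop: `k := k ⇂ 1`, cost `2`. [folklore] -/
theorem runs_pop1 (k : ι) (R : Regs ι) :
    Runs (pop k skip skip skip) R (Function.update R k ((R k).drop 1)) 2 := by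
  rcases hk : R k with _ | ⟨b, w⟩
  · refine (Runs.pop_nil skip skip hk (Runs.skip R)).congr ?_
    rw [← hk, List.drop_one, hk, List.tail_nil, ← hk, Function.update_eq_self]
  · cases b
    · exact Runs.pop_false skip skip hk (Runs.skip _)
    · exact Runs.pop_true skip skip hk (Runs.skip _)

/-- `popK k m`: pop register `k` (at most) `m` times. [folklore] -/
def popK (k : ι) : ℕ → Com ι
  | 0 => skip
  | m + 1 => pop k skip skip skip ;; popK k m

/-- Effect of `popK`: `k := k ⇂ m`, cost `≤ 2m`. [folklore] -/
theorem runs_popK (k : ι) : ∀ (m : ℕ) (R : Regs ι),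
    Runs (popK k m) R (Function.update R k ((R k).drop m)) (2 * m)
  | 0, R => by
    show Runs skip R _ _
    exact (Runs.skip R).of_eq (by simp) (by simp)
  | m + 1, R => by
    have h1 := runs_pop1 k R
    have h2 := runs_popK k m (Function.update R k ((R k).drop 1))
    refine (h1.seq h2).of_eq ?_ (by omega)
    rw [Function.update_idem, Function.update_self, List.drop_drop, Nat.add_comm]

/-- `pushK k m`: push `m` units on register `k`. [folklore] -/
def pushK (k : ι) : ℕ → Com ι
  | 0 => skip
  | m + 1 => push k true ;; pushK k m

/-- Effect of `pushK`: `k := 1ᵐ ++ k`, cost `m`. [folklore] -/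
theorem runs_pushK (k : ι) : ∀ (m : ℕ) (R : Regs ι),
    Runs (pushK k m) R (Function.update R k (ones m ++ R k)) m
  | 0, R => by
    show Runs skip R _ _
    exact (Runs.skip R).of_eq (by simp) (by simp)
  | m + 1, R => by
    have h1 := Runs.push k true R
    have h2 := runs_pushK k m (Function.update R k (true :: R k))
    refine (h1.seq h2).of_eq ?_ (by omega)
    rw [Function.update_idem, Function.update_self]
    simp [ones, List.replicate_succ']

/-- `subFrom x y`: `x := x ⇂ |y|` (truncated subtraction of counters), emptying `y`; the bits of
`y` are irrelevant. [folklore] -/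
def subFrom (x y : ι) : Com ι := loop y (pop x skip skip skip) (pop x skip skip skip)

/-- Effect of `subFrom` (cost `≤ 4|y| + 1`). [folklore] -/
theorem runs_subFrom {x y : ι} (hxy : x ≠ y) : ∀ (w : List Bool) (R : Regs ι), R y = w →
    Runs (subFrom x y) R (Function.update (Function.update R y []) x ((R x).drop w.length))
      (4 * w.length + 1)
  | [], R, hR => by
    refine (Runs.loop_nil _ _ hR).of_eq ?_ (by simp)
    ext i : 1
    simp only [Function.update_apply, List.length_nil, List.drop_zero]
    split_ifs <;> simp_all
  | b :: w, R, hR => by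
    have hbody : Runs (pop x skip skip skip) (Function.update R y w)
        (Function.update (Function.update R y w) x ((R x).drop 1)) 2 := by
      have := runs_pop1 x (Function.update R y w)
      rwa [Function.update_of_ne hxy] at this
    have ih := runs_subFrom hxy w (Function.update (Function.update R y w) x ((R x).drop 1))
      (by rw [Function.update_of_ne hxy.symm, Function.update_self])
    have hfin : Function.update (Function.update (Function.update (Function.update R y w) x ((R x).drop 1)) y [])
        x ((Function.update (Function.update R y w) x ((R x).drop 1) x).drop w.length) =
        Function.update (Function.update R y []) x ((R x).drop (b :: w).length) := by
      rw [Function.update_self, List.drop_drop, Function.update_comm hxy, Function.update_idem,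
        Function.update_idem, List.length_cons, Nat.add_comm]
    rw [show 4 * (b :: w).length + 1 = 2 + 2 + (4 * w.length + 1) by simp; ring]
    cases b
    · exact Runs.loop_false hR hbody (ih.congr hfin)
    · exact Runs.loop_true hR hbody (ih.congr hfin)

/-- `addReg p v t`: `v` gains `|p|` units; `p` is consumed and restored from the scratch `t`
(which must be empty). [folklore] -/
def addReg (p v t : ι) : Com ι := loop p (push v true ;; push t true) (push v true ;; push t true) ;; pour t p

/-- The loop of `addReg`: `v := 1^{|p|} ++ v`, `t := 1^{|p|} ++ t`, `p := []`, cost `4|p| + 1`. [folklore] -/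
theorem runs_addReg_loop {p v t : ι} (hpv : p ≠ v) (hpt : p ≠ t) (hvt : v ≠ t) :
    ∀ (w : List Bool) (R : Regs ι), R p = w →
    Runs (loop p (push v true ;; push t true) (push v true ;; push t true)) R
      (Function.update (Function.update (Function.update R p []) v (ones w.length ++ R v)) t (ones w.length ++ R t))
      (4 * w.length + 1)
  | [], R, hR => by
    refine (Runs.loop_nil _ _ hR).of_eq ?_ (by simp)
    ext i : 1
    simp only [Function.update_apply]
    split_ifs <;> simp_all
  | b :: w, R, hR => by
    have hbody : Runs (push v true ;; push t true) (Function.update R p w)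
        (Function.update (Function.update (Function.update R p w) v (true :: R v)) t (true :: R t)) (1 + 1) := by
      refine ((Runs.push v true _).seq (Runs.push t true _)).of_eq ?_ le_rfl
      simp [Function.update_of_ne hpv.symm, Function.update_of_ne hpt.symm, Function.update_of_ne hvt.symm]
    have ih := runs_addReg_loop hpv hpt hvt w
      (Function.update (Function.update (Function.update R p w) v (true :: R v)) t (true :: R t))
      (by simp [Function.update_of_ne hpt, Function.update_of_ne hpv])
    rw [show 4 * (b :: w).length + 1 = (1 + 1) + 2 + (4 * w.length + 1) by simp; ring]
    have hfin : Function.update (Function.update (Function.update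
          (Function.update (Function.update (Function.update R p w) v (true :: R v)) t (true :: R t)) p [])
          v (ones w.length ++ (Function.update (Function.update (Function.update R p w) v (true :: R v)) t (true :: R t)) v))
          t (ones w.length ++ (Function.update (Function.update (Function.update R p w) v (true :: R v)) t (true :: R t)) t) =
        Function.update (Function.update (Function.update R p []) v (ones (b :: w).length ++ R v)) t
          (ones (b :: w).length ++ R t) := by
      ext i : 1
      simp only [Function.update_apply, List.length_cons]
      split_ifs <;> simp_all [ones, List.replicate_succ']
    cases b
    · exact Runs.loop_false hR hbody (ih.congr hfin)
    · exact Runs.loop_true hR hbody (ih.congr hfin)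

/-- **Effect of `addReg`** (cost `7|p| + 2`): `v := 1^{|p|} ++ v`, `p := 1^{|p|}` (restored as a
counter), `t` empty again. [folklore] -/
theorem runs_addReg {p v t : ι} (hpv : p ≠ v) (hpt : p ≠ t) (hvt : v ≠ t) (R : Regs ι) (ht : R t = []) :
    Runs (addReg p v t) R (Function.update (Function.update R p (ones (R p).length)) v (ones (R p).length ++ R v))
      (7 * (R p).length + 2) := by
  have h1 := runs_addReg_loop hpv hpt hvt (R p) R rfl
  set R₁ := Function.update (Function.update (Function.update R p []) v (ones (R p).length ++ R v)) t
    (ones (R p).length ++ R t)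
  have h2 := runs_pour hpt.symm R₁
  refine (h1.seq h2).of_eq ?_ ?_
  · ext i : 1
    simp only [R₁, Function.update_apply, ht, List.append_nil]
    split_ifs <;> simp_all [ones]
  · simp [R₁, ht]; omega

/-- `dblReg p t`: `p := 1^{2|p|}` via the empty scratch `t`. [folklore] -/
def dblReg (p t : ι) : Com ι := loop p (push t true ;; push t true) (push t true ;; push t true) ;; pour t p

/-- The loop of `dblReg`: `t := 1^{2|p|} ++ t`, `p := []`, cost `4|p| + 1`. [folklore] -/
theorem runs_dblReg_loop {p t : ι} (hpt : p ≠ t) : ∀ (w : List Bool) (R : Regs ι), R p = w →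
    Runs (loop p (push t true ;; push t true) (push t true ;; push t true)) R
      (Function.update (Function.update R p []) t (ones (2 * w.length) ++ R t)) (4 * w.length + 1)
  | [], R, hR => by
    refine (Runs.loop_nil _ _ hR).of_eq ?_ (by simp)
    ext i : 1
    simp only [Function.update_apply]
    split_ifs <;> simp_all
  | b :: w, R, hR => by
    have hbody : Runs (push t true ;; push t true) (Function.update R p w)
        (Function.update (Function.update R p w) t (true :: true :: R t)) (1 + 1) := by
      refine ((Runs.push t true _).seq (Runs.push t true _)).of_eq ?_ le_rfl
      simp [Function.update_of_ne hpt.symm]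
    have ih := runs_dblReg_loop hpt w (Function.update (Function.update R p w) t (true :: true :: R t))
      (by simp [Function.update_of_ne hpt])
    rw [show 4 * (b :: w).length + 1 = (1 + 1) + 2 + (4 * w.length + 1) by simp; ring]
    have hfin : Function.update (Function.update (Function.update (Function.update R p w) t (true :: true :: R t)) p [])
          t (ones (2 * w.length) ++ (Function.update (Function.update R p w) t (true :: true :: R t)) t) =
        Function.update (Function.update R p []) t (ones (2 * (b :: w).length) ++ R t) := by
      ext i : 1
      simp only [Function.update_apply, List.length_cons]
      split_ifs <;> simp_all [ones, List.replicate_succ', show 2 * (w.length + 1) = 2 * w.length + 1 + 1 by ring]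
    cases b
    · exact Runs.loop_false hR hbody (ih.congr hfin)
    · exact Runs.loop_true hR hbody (ih.congr hfin)

/-- **Effect of `dblReg`** (cost `10|p| + 2`): `p := 1^{2|p|}`, `t` empty again. [folklore] -/
theorem runs_dblReg {p t : ι} (hpt : p ≠ t) (R : Regs ι) (ht : R t = []) :
    Runs (dblReg p t) R (Function.update R p (ones (2 * (R p).length))) (10 * (R p).length + 2) := by
  have h1 := runs_dblReg_loop hpt (R p) R rfl
  set R₁ := Function.update (Function.update R p []) t (ones (2 * (R p).length) ++ R t)
  have h2 := runs_pour hpt.symm R₁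
  refine (h1.seq h2).of_eq ?_ ?_
  · ext i : 1
    simp only [R₁, Function.update_apply, ht, List.append_nil]
    split_ifs <;> simp_all [ones]
  · simp [R₁, ht]; omega

/-! ### Moving data under a counter -/

/-- `takeN q s d`: move `|q|` symbols (or as many as there are) from `s` onto `d`, consuming
the counter `q`. [folklore] -/
def takeN (q s d : ι) : Com ι := loop q (pop s (push d true) (push d false) skip) (pop s (push d true) (push d false) skip)

/-- **Effect of `takeN`** (cost `≤ 5|q| + 1`): `d := reverse (s ↾ |q|) ++ d`, `s := s ⇂ |q|`,
`q := []`. [folklore] -/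
theorem runs_takeN {q s d : ι} (hqs : q ≠ s) (hqd : q ≠ d) (hsd : s ≠ d) :
    ∀ (w : List Bool) (R : Regs ι), R q = w →
    Runs (takeN q s d) R
      (Function.update (Function.update (Function.update R q []) s ((R s).drop w.length)) d
        (((R s).take w.length).reverse ++ R d)) (5 * w.length + 1)
  | [], R, hR => by
    refine (Runs.loop_nil _ _ hR).of_eq ?_ (by simp)
    ext i : 1
    simp only [Function.update_apply, List.length_nil, List.drop_zero, List.take_zero, List.reverse_nil,
      List.nil_append]
    split_ifs <;> simp_all
  | b :: w, R, hR => by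
    rcases hs : R s with _ | ⟨c, u⟩
    · -- source exhausted: the body skips
      have hbody : Runs (pop s (push d true) (push d false) skip) (Function.update R q w)
          (Function.update R q w) (1 + 2) :=
        (Runs.pop_nil _ _ (by rw [Function.update_of_ne hqs.symm, hs]) (Runs.skip _)).mono (by norm_num)
      have ih := runs_takeN hqs hqd hsd w (Function.update R q w) (by simp)
      rw [show 5 * (b :: w).length + 1 = (1 + 2) + 2 + (5 * w.length + 1) by simp; ring]
      have hfin : Function.update (Function.update (Function.update (Function.update R q w) q [])
            s ((Function.update R q w s).drop w.length)) d
            (((Function.update R q w s).take w.length).reverse ++ Function.update R q w d) =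
          Function.update (Function.update (Function.update R q []) s (([] : List Bool).drop (b :: w).length)) d
            ((([] : List Bool).take (b :: w).length).reverse ++ R d) := by
        ext i : 1
        simp only [Function.update_apply]
        split_ifs <;> simp_all
      cases b
      · exact Runs.loop_false hR hbody (ih.congr hfin)
      · exact Runs.loop_true hR hbody (ih.congr hfin)
    · have hbody : Runs (pop s (push d true) (push d false) skip) (Function.update R q w)
          (Function.update (Function.update (Function.update R q w) s u) d (c :: R d)) (1 + 2) := by
        have hsq : Function.update R q w s = c :: u := by rw [Function.update_of_ne hqs.symm, hs]
        cases c
        · refine Runs.pop_false _ _ hsq ((Runs.push d false _).of_eq ?_ le_rfl)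
          simp [Function.update_of_ne hsd.symm, Function.update_of_ne hqd.symm]
        · refine Runs.pop_true _ _ hsq ((Runs.push d true _).of_eq ?_ le_rfl)
          simp [Function.update_of_ne hsd.symm, Function.update_of_ne hqd.symm]
      have ih := runs_takeN hqs hqd hsd w (Function.update (Function.update (Function.update R q w) s u) d (c :: R d))
        (by simp [Function.update_of_ne hqd, Function.update_of_ne hqs])
      rw [show 5 * (b :: w).length + 1 = (1 + 2) + 2 + (5 * w.length + 1) by simp; ring]
      have hfin : Function.update (Function.update (Function.update
            (Function.update (Function.update (Function.update R q w) s u) d (c :: R d)) q [])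
            s ((Function.update (Function.update (Function.update R q w) s u) d (c :: R d) s).drop w.length)) d
            (((Function.update (Function.update (Function.update R q w) s u) d (c :: R d) s).take w.length).reverse ++
              Function.update (Function.update (Function.update R q w) s u) d (c :: R d) d) =
          Function.update (Function.update (Function.update R q []) s ((c :: u).drop (b :: w).length)) d
            (((c :: u).take (b :: w).length).reverse ++ R d) := by
        ext i : 1
        simp only [Function.update_apply, List.length_cons]
        split_ifs <;> simp_all
      cases b
      · exact Runs.loop_false hR hbody (ih.congr hfin)
      · exact Runs.loop_true hR hbody (ih.congr hfin)

/-- `pourDbl k o`: pour register `k` onto `o`, doubling each bit. [folklore] -/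
def pourDbl (k o : ι) : Com ι := loop k (push o true ;; push o true) (push o false ;; push o false)

/-- **Effect of `pourDbl`** (cost `4|k| + 1`): `o := dbl (reverse k) ++ o` with the bit doubling
`SProg.dbl` of `StackMachines.lean`, `k := []`. [folklore] -/
theorem runs_pourDbl {k o : ι} (hk : k ≠ o) : ∀ (w : List Bool) (R : Regs ι), R k = w →
    Runs (pourDbl k o) R (Function.update (Function.update R k []) o (SProg.dbl w.reverse ++ R o))
      (4 * w.length + 1)
  | [], R, hR => by
    refine (Runs.loop_nil _ _ hR).of_eq ?_ (by simp)
    ext i : 1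
    simp only [Function.update_apply, List.reverse_nil, SProg.dbl_nil, List.nil_append]
    split_ifs <;> simp_all
  | b :: w, R, hR => by
    have hko : o ≠ k := fun h => hk h.symm
    have hbody : ∀ c : Bool, Runs (push o c ;; push o c) (Function.update R k w)
        (Function.update (Function.update R k w) o (c :: c :: R o)) (1 + 1) := fun c => by
      refine ((Runs.push o c _).seq (Runs.push o c _)).of_eq ?_ le_rfl
      simp [Function.update_of_ne hko]
    have ih : ∀ c : Bool, Runs (pourDbl k o) (Function.update (Function.update R k w) o (c :: c :: R o))
        (Function.update (Function.update R k []) o (SProg.dbl (c :: w).reverse ++ R o)) (4 * w.length + 1) := by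
      intro c
      refine (runs_pourDbl hk w _ (by rw [Function.update_of_ne hk, Function.update_self])).of_eq ?_ le_rfl
      have hd : SProg.dbl (w.reverse ++ [c]) = SProg.dbl w.reverse ++ [c, c] := by
        simp [SProg.dbl, List.flatMap_append]
      rw [Function.update_self, List.reverse_cons, hd, List.append_assoc]
      simp only [List.cons_append, List.nil_append]
      rw [Function.update_comm hko, Function.update_idem, Function.update_idem]
    rw [show 4 * (b :: w).length + 1 = (1 + 1) + 2 + (4 * w.length + 1) by simp; ring]
    cases b
    · exact Runs.loop_false hR (hbody false) (ih false)
    · exact Runs.loop_true hR (hbody true) (ih true)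

/-! ### Horner evaluation of `ℕ`-polynomials in unary -/

/-- `mulReg n a a2 t`: `a2` gains `|a| · |n|` units, emptying the counter `a` (one `addReg n a2 t`
per unit of `a`). [folklore] -/
def mulReg (n a a2 t : ι) : Com ι := loop a (addReg n a2 t) (addReg n a2 t)

/-- **Effect of `mulReg`** (cost `≤ A (7N + 4) + 1` for `a = 1ᴬ`, `n = 1ᴺ`). [folklore] -/
theorem runs_mulReg {n a a2 t : ι} (hna : n ≠ a) (hna2 : n ≠ a2) (hnt : n ≠ t) (haa2 : a ≠ a2) (hat : a ≠ t)
    (ha2t : a2 ≠ t) (N : ℕ) : ∀ (A : ℕ) (R : Regs ι), R n = ones N → R a = ones A → R t = [] →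
    Runs (mulReg n a a2 t) R (Function.update (Function.update R a []) a2 (ones (A * N) ++ R a2)) (A * (7 * N + 4) + 1)
  | 0, R, hn, ha, ht => by
    refine (Runs.loop_nil _ _ ha).of_eq ?_ (by simp)
    ext i : 1
    simp only [Function.update_apply]
    split_ifs <;> simp_all
  | A + 1, R, hn, ha, ht => by
    have hbody := runs_addReg hna2 hnt ha2t (Function.update R a (ones A))
      (by rw [Function.update_of_ne hat.symm, ht])
    rw [Function.update_of_ne hna, Function.update_of_ne haa2.symm, hn, List.length_replicate] at hbody
    set R₁ := Function.update (Function.update (Function.update R a (ones A)) n (ones N)) a2 (ones N ++ R a2)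
    have ih := runs_mulReg hna hna2 hnt haa2 hat ha2t N A R₁
      (by simp [R₁, Function.update_of_ne hna2])
      (by simp [R₁, Function.update_of_ne haa2, Function.update_of_ne hna.symm])
      (by simp [R₁, Function.update_of_ne ha2t.symm, Function.update_of_ne hnt.symm, Function.update_of_ne hat.symm, ht])
    rw [show (A + 1) * (7 * N + 4) + 1 = (7 * N + 2) + 2 + (A * (7 * N + 4) + 1) by ring]
    refine Runs.loop_true ha hbody (ih.of_eq ?_ le_rfl)
    have hun : ones (A * N) ++ (ones N ++ R a2) = ones ((A + 1) * N) ++ R a2 := by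
      rw [← List.append_assoc, ones_append, Nat.succ_mul]
    ext i : 1
    simp only [R₁, Function.update_apply]
    split_ifs <;> simp_all

/-- One Horner step `a := a · n + c` (via `a2`, which must be empty, and the scratch `t`). [folklore] -/
def hornerStep (n a a2 t : ι) (c : ℕ) : Com ι := mulReg n a a2 t ;; pour a2 a ;; pushK a c

/-- **Effect of one Horner step** (cost `≤ A (10N + 4) + c + 2`). [folklore] -/
theorem runs_hornerStep {n a a2 t : ι} (hna : n ≠ a) (hna2 : n ≠ a2) (hnt : n ≠ t) (haa2 : a ≠ a2)
    (hat : a ≠ t) (ha2t : a2 ≠ t) (c N A : ℕ) (R : Regs ι) (hn : R n = ones N) (ha : R a = ones A)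
    (ha2 : R a2 = []) (ht : R t = []) :
    Runs (hornerStep n a a2 t c) R (Function.update R a (ones (A * N + c))) (A * (10 * N + 4) + c + 2) := by
  have h1 := runs_mulReg hna hna2 hnt haa2 hat ha2t N A R hn ha ht
  rw [ha2, List.append_nil] at h1
  set R₁ := Function.update (Function.update R a []) a2 (ones (A * N))
  have h2 := runs_pour haa2.symm R₁
  have hR₁a2 : R₁ a2 = ones (A * N) := by simp [R₁]
  have hR₁a : R₁ a = [] := by simp [R₁, Function.update_of_ne haa2]
  rw [hR₁a2, hR₁a, List.append_nil, List.reverse_replicate, List.length_replicate] at h2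
  set R₂ := Function.update (Function.update R₁ a2 []) a (ones (A * N))
  have h3 := runs_pushK a c R₂
  have hR₂a : R₂ a = ones (A * N) := by simp [R₂]
  rw [hR₂a, ones_append, Nat.add_comm c] at h3
  refine ((h1.seq (h2.seq h3)).of_eq ?_ (by nlinarith))
  ext i : 1
  simp only [R₂, R₁, Function.update_apply]
  split_ifs <;> simp_all

/-- Horner evaluation along a list of coefficients (highest first). [Knuth, TAOCP 2, §4.6.4] [folklore] -/
def hornerProg (n a a2 t : ι) : List ℕ → Com ι
  | [] => skip
  | c :: cs => hornerStep n a a2 t c ;; hornerProg n a a2 t cs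

/-- The Horner recursion on values. [folklore] -/
def hornerVal (N : ℕ) (A : ℕ) (cs : List ℕ) : ℕ := cs.foldl (fun A c => A * N + c) A

/-- With `N ≥ 1` the Horner values increase along the list. [folklore] -/
theorem le_hornerVal {N : ℕ} (hN : 1 ≤ N) : ∀ (cs : List ℕ) (A : ℕ), A ≤ hornerVal N A cs
  | [], _ => le_rfl
  | c :: cs, A => by
    have := le_hornerVal hN cs (A * N + c)
    rw [hornerVal, List.foldl_cons]
    exact le_trans (by nlinarith) this

/-- **Effect of Horner evaluation** with a uniform bound `B` on all intermediate values and
coefficients (cost `≤ |cs| · (B (10N + 5) + 2)`). [Knuth, TAOCP 2, §4.6.4] [folklore] -/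
theorem runs_hornerProg {n a a2 t : ι} (hna : n ≠ a) (hna2 : n ≠ a2) (hnt : n ≠ t) (haa2 : a ≠ a2)
    (hat : a ≠ t) (ha2t : a2 ≠ t) (N B : ℕ) : ∀ (cs : List ℕ) (A : ℕ), A ≤ B → (∀ c ∈ cs, c ≤ B) →
    hornerVal N A cs ≤ B → ∀ (R : Regs ι), R n = ones N → R a = ones A → R a2 = [] → R t = [] →
    Runs (hornerProg n a a2 t cs) R (Function.update R a (ones (hornerVal N A cs))) (cs.length * (B * (10 * N + 5) + 2))
  | [], A, _, _, _, R, _, ha, _, _ => by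
    show Runs skip R _ _
    refine (Runs.skip R).of_eq ?_ (by simp)
    rw [hornerVal, List.foldl_nil, ← ha, Function.update_eq_self]
  | c :: cs, A, hA, hcs, hF, R, hn, ha, ha2, ht => by
    have hc : c ≤ B := hcs c (by simp)
    have hA' : A * N + c ≤ B := by
      rcases Nat.eq_zero_or_pos N with rfl | hN
      · simpa using hc
      · exact le_trans (le_hornerVal hN cs _) hF
    have h1 := runs_hornerStep hna hna2 hnt haa2 hat ha2t c N A R hn ha ha2 ht
    have h2 := runs_hornerProg hna hna2 hnt haa2 hat ha2t N B cs (A * N + c) hA' (fun c' hc' => hcs c' (by simp [hc'])) hF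
      (Function.update R a (ones (A * N + c))) (by rw [Function.update_of_ne hna, hn]) (by simp)
      (by rw [Function.update_of_ne haa2.symm, ha2]) (by rw [Function.update_of_ne hat.symm, ht])
    rw [Function.update_idem] at h2
    refine (h1.seq h2).of_eq rfl ?_
    have : A * (10 * N + 4) + c + 2 ≤ B * (10 * N + 5) + 2 := by nlinarith
    simp only [List.length_cons]
    nlinarith

/-- The coefficient list of a polynomial, highest degree first. [folklore] -/
noncomputable def coeffsHL (Q : Polynomial ℕ) : List ℕ :=
  ((List.range (Q.natDegree + 1)).map Q.coeff).reverse

/-- Length of the coefficient list. [folklore] -/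
theorem length_coeffsHL (Q : Polynomial ℕ) : (coeffsHL Q).length = Q.natDegree + 1 := by
  simp [coeffsHL]

/-- Horner along a reversed range of coefficients is the partial sum of the polynomial. [folklore] -/
theorem hornerVal_range (Q : Polynomial ℕ) (N : ℕ) : ∀ (d A : ℕ),
    hornerVal N A ((List.range (d + 1)).map Q.coeff).reverse =
      A * N ^ (d + 1) + ∑ i ∈ Finset.range (d + 1), Q.coeff i * N ^ i
  | 0, A => by simp [hornerVal, List.range_succ]
  | d + 1, A => by
    have ih := hornerVal_range Q N d (A * N + Q.coeff (d + 1))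
    rw [List.range_succ, List.map_append, List.reverse_append, List.map_singleton, List.reverse_singleton,
      List.singleton_append, hornerVal, List.foldl_cons, ← hornerVal, ih, Finset.sum_range_succ _ (d + 1)]
    ring

/-- **Horner evaluation computes `Q(N)`.** [Knuth, TAOCP 2, §4.6.4] [folklore] -/
theorem hornerVal_coeffsHL (Q : Polynomial ℕ) (N : ℕ) : hornerVal N 0 (coeffsHL Q) = Q.eval N := by
  rw [coeffsHL, hornerVal_range, zero_mul, zero_add, Polynomial.eval_eq_sum_range]

/-- Coefficients are bounded by the value at `1`. [folklore] -/
theorem coeff_le_eval_one (Q : Polynomial ℕ) (i : ℕ) : Q.coeff i ≤ Q.eval 1 := by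
  rw [Polynomial.eval_eq_sum_range]
  simp only [one_pow, mul_one]
  by_cases hi : i < Q.natDegree + 1
  · exact Finset.single_le_sum (f := fun i => Q.coeff i) (fun _ _ => Nat.zero_le _) (Finset.mem_range.2 hi)
  · rw [Polynomial.coeff_eq_zero_of_natDegree_lt (by omega)]
    exact Nat.zero_le _

/-- Members of the coefficient list are coefficients. [folklore] -/
theorem mem_coeffsHL {Q : Polynomial ℕ} {c : ℕ} (hc : c ∈ coeffsHL Q) : ∃ i, c = Q.coeff i := by
  simp only [coeffsHL, List.mem_reverse, List.mem_map, List.mem_range] at hc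
  obtain ⟨i, _, rfl⟩ := hc
  exact ⟨i, rfl⟩

/-- **Evaluation program**: `hornerProg n a a2 t (coeffsHL Q)` turns `a = []` into `a = 1^{Q(N)}`
(`n = 1ᴺ` kept, `a2`, `t` empty scratch) in `(deg Q + 1) · (Q(N+1) · (10 N + 5) + 2)` steps.
[Arora–Barak 2009, §3.1 (polynomials are time-constructible)] [cite: AroraBarakCC2009, §1.3] -/
theorem runs_evalPoly {n a a2 t : ι} (hna : n ≠ a) (hna2 : n ≠ a2) (hnt : n ≠ t) (haa2 : a ≠ a2)
    (hat : a ≠ t) (ha2t : a2 ≠ t) (Q : Polynomial ℕ) (N : ℕ) (R : Regs ι) (hn : R n = ones N) (ha : R a = [])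
    (ha2 : R a2 = []) (ht : R t = []) :
    Runs (hornerProg n a a2 t (coeffsHL Q)) R (Function.update R a (ones (Q.eval N)))
      ((Q.natDegree + 1) * (Q.eval (N + 1) * (10 * N + 5) + 2)) := by
  have hB : ∀ c ∈ coeffsHL Q, c ≤ Q.eval (N + 1) := fun c hc => by
    obtain ⟨i, rfl⟩ := mem_coeffsHL hc
    exact (coeff_le_eval_one Q i).trans (TM2Iter.eval_mono Q (by omega))
  have hF : hornerVal N 0 (coeffsHL Q) ≤ Q.eval (N + 1) := by
    rw [hornerVal_coeffsHL]; exact TM2Iter.eval_mono Q (Nat.le_succ N)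
  have := runs_hornerProg hna hna2 hnt haa2 hat ha2t N (Q.eval (N + 1)) (coeffsHL Q) 0 (Nat.zero_le _) hB hF R hn ha ha2 ht
  rwa [hornerVal_coeffsHL, length_coeffsHL] at this

/-! ### Binary logarithm by repeated halving -/

/-- `halve v a`: `a` gains `⌊|v| / 2⌋` units, `v` is emptied. [folklore] -/
def halve (v a : ι) : Com ι := loop v (pop v (push a true) (push a true) skip) (pop v (push a true) (push a true) skip)

/-- **Effect of `halve`** (cost `≤ 5V + 1` on `v = 1ⱽ`). [folklore] -/
theorem runs_halve {v a : ι} (hva : v ≠ a) : ∀ (V : ℕ) (R : Regs ι), R v = ones V →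
    Runs (halve v a) R (Function.update (Function.update R v []) a (ones (V / 2) ++ R a)) (5 * V + 1)
  | 0, R, hR => by
    refine (Runs.loop_nil _ _ hR).of_eq ?_ (by simp)
    ext i : 1
    simp only [Function.update_apply]
    split_ifs <;> simp_all
  | 1, R, hR => by
    have hbody : Runs (pop v (push a true) (push a true) skip) (Function.update R v [])
        (Function.update R v []) 2 := Runs.pop_nil _ _ (by simp) (Runs.skip _)
    have hrest : Runs (halve v a) (Function.update R v []) (Function.update R v []) 1 :=
      Runs.loop_nil _ _ (by simp)
    refine (Runs.loop_true hR hbody hrest).of_eq ?_ (by norm_num)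
    ext i : 1
    simp only [Function.update_apply]
    split_ifs <;> simp_all
  | V + 2, R, hR => by
    have hbody : Runs (pop v (push a true) (push a true) skip) (Function.update R v (ones (V + 1)))
        (Function.update (Function.update R v (ones V)) a (true :: R a)) (1 + 2) := by
      refine Runs.pop_true _ _ (show Function.update R v (ones (V + 1)) v = true :: ones V by simp [ones_succ])
        ((Runs.push a true _).of_eq ?_ le_rfl)
      rw [Function.update_idem]
      simp [Function.update_of_ne hva.symm]
    have ih := runs_halve hva V (Function.update (Function.update R v (ones V)) a (true :: R a))
      (by simp [Function.update_of_ne hva])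
    refine (Runs.loop_true hR hbody ih).of_eq ?_ (by omega)
    ext i : 1
    simp only [Function.update_apply]
    split_ifs <;> simp_all [ones, List.replicate_succ', show (V + 2) / 2 = V / 2 + 1 by omega]

/-- One step of the logarithm: for `|v| ≥ 2`, `v := 1^{⌊|v|/2⌋}` and one unit on `d`; for
`|v| ≤ 1`, `v := []` (via the empty scratch `a`). [folklore] -/
def logBody (v a d : ι) : Com ι :=
  pop v (pop v (push a true ;; halve v a ;; pour a v ;; push d true) (push a true ;; halve v a ;; pour a v ;; push d true) skip)
    (pop v (push a true ;; halve v a ;; pour a v ;; push d true) (push a true ;; halve v a ;; pour a v ;; push d true) skip)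
    skip

/-- `logCount f v a d`: repeat `logBody` once per unit of the fuel `f`. [folklore] -/
def logCount (f v a d : ι) : Com ι := loop f (logBody v a d) (logBody v a d)

/-- The arithmetic of one logarithm step on `(value, count)`. [folklore] -/
def logStepC (p : ℕ × ℕ) : ℕ × ℕ := (p.1 / 2, if 2 ≤ p.1 then p.2 + 1 else p.2)

/-- The arithmetic of the logarithm loop. [folklore] -/
def logC : ℕ → ℕ × ℕ → ℕ × ℕ
  | 0, p => p
  | f + 1, p => logC f (logStepC p)

/-- **Effect of one logarithm step** (cost `≤ 7V + 11` on `v = 1ⱽ`, `d = 1ᴰ`, `a = []`). [folklore] -/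
theorem runs_logBody {v a d : ι} (hva : v ≠ a) (hvd : v ≠ d) (had : a ≠ d) (V D : ℕ) (R : Regs ι)
    (hv : R v = ones V) (ha : R a = []) (hd : R d = ones D) :
    Runs (logBody v a d) R
      (Function.update (Function.update R v (ones (logStepC (V, D)).1)) d (ones (logStepC (V, D)).2)) (7 * V + 11) := by
  unfold logBody
  rcases V with _ | _ | V
  · refine (Runs.pop_nil _ _ hv (Runs.skip R)).of_eq ?_ (by norm_num)
    ext i : 1
    simp only [Function.update_apply, logStepC]
    split_ifs <;> simp_all
  · have h : Runs (pop v (push a true ;; halve v a ;; pour a v ;; push d true)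
        (push a true ;; halve v a ;; pour a v ;; push d true) skip) (Function.update R v []) (Function.update R v []) 2 :=
      Runs.pop_nil _ _ (by simp) (Runs.skip _)
    refine (Runs.pop_true _ _ hv h).of_eq ?_ (by norm_num)
    ext i : 1
    simp only [Function.update_apply, logStepC]
    split_ifs <;> simp_all
  · -- `V + 2 ≥ 2`: halve
    set R₀ := Function.update R v (ones V)
    have h1 : Runs (push a true) R₀ (Function.update R₀ a (ones 1)) 1 :=
      (Runs.push a true R₀).of_eq (by simp [R₀, Function.update_of_ne hva.symm, ha]) le_rfl
    have h2 := runs_halve hva V (Function.update R₀ a (ones 1)) (by simp [R₀, Function.update_of_ne hva])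
    rw [Function.update_self, ones_append] at h2
    set R₂ := Function.update (Function.update (Function.update R₀ a (ones 1)) v []) a (ones (V / 2 + 1))
    have h3 := runs_pour (a := a) (b := v) hva.symm R₂
    have hR₂a : R₂ a = ones (V / 2 + 1) := by simp [R₂]
    have hR₂v : R₂ v = [] := by simp [R₂, Function.update_of_ne hva]
    rw [hR₂a, hR₂v, List.append_nil, List.reverse_replicate, List.length_replicate] at h3
    set R₃ := Function.update (Function.update R₂ a []) v (ones (V / 2 + 1))
    have h4 : Runs (push d true) R₃ (Function.update R₃ d (ones (D + 1))) 1 :=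
      (Runs.push d true R₃).of_eq (by simp [R₃, R₂, R₀, Function.update_of_ne had.symm, Function.update_of_ne hvd.symm, hd, ones_succ]) le_rfl
    have h1234 := h1.seq (h2.seq (h3.seq h4))
    have hstep : logStepC (V + 1 + 1, D) = (V / 2 + 1, D + 1) := by
      simp [logStepC]; omega
    rw [hstep]
    refine (Runs.pop_true _ _ hv (Runs.pop_true' _ _
      (show Function.update R v (ones (V + 1)) v = true :: ones V by simp [ones_succ])
      (by rw [Function.update_idem]) (h1234.of_eq ?_ le_rfl))).mono (by omega)
    ext i : 1
    simp only [R₃, R₂, R₀, Function.update_apply]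
    split_ifs <;> simp_all

/-- The value only decreases. [folklore] -/
theorem logStepC_fst_le (p : ℕ × ℕ) : (logStepC p).1 ≤ p.1 := Nat.div_le_self _ _

/-- **Effect of the logarithm loop** (cost `≤ F (7V + 13) + 1`). [folklore] -/
theorem runs_logCount {f v a d : ι} (hfv : f ≠ v) (hfa : f ≠ a) (hfd : f ≠ d) (hva : v ≠ a) (hvd : v ≠ d)
    (had : a ≠ d) : ∀ (F V D : ℕ) (R : Regs ι), R f = ones F → R v = ones V → R a = [] → R d = ones D →
    Runs (logCount f v a d) R
      (Function.update (Function.update (Function.update R f []) v (ones (logC F (V, D)).1)) d (ones (logC F (V, D)).2))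
      (F * (7 * V + 13) + 1)
  | 0, V, D, R, hf, hv, ha, hd => by
    refine (Runs.loop_nil _ _ hf).of_eq ?_ (by simp)
    ext i : 1
    simp only [Function.update_apply, logC]
    split_ifs <;> simp_all
  | F + 1, V, D, R, hf, hv, ha, hd => by
    have hbody := runs_logBody hva hvd had V D (Function.update R f (ones F))
      (by rw [Function.update_of_ne hfv.symm, hv]) (by rw [Function.update_of_ne hfa.symm, ha])
      (by rw [Function.update_of_ne hfd.symm, hd])
    set R₁ := Function.update (Function.update (Function.update R f (ones F)) v (ones (logStepC (V, D)).1)) d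
      (ones (logStepC (V, D)).2)
    have ih := runs_logCount hfv hfa hfd hva hvd had F (logStepC (V, D)).1 (logStepC (V, D)).2 R₁
      (by simp [R₁, Function.update_of_ne hfd, Function.update_of_ne hfv])
      (by simp [R₁, Function.update_of_ne hvd]) 
      (by simp [R₁, Function.update_of_ne had, Function.update_of_ne hva.symm, Function.update_of_ne hfa.symm, ha])
      (by simp [R₁])
    have hle : (logStepC (V, D)).1 ≤ V := logStepC_fst_le (V, D)
    simp only [logC]
    refine (Runs.loop_true hf hbody (ih.of_eq ?_ le_rfl)).mono ?_
    · ext i : 1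
      simp only [R₁, Function.update_apply]
      split_ifs <;> simp_all
    · have : F * (7 * (logStepC (V, D)).1 + 13) ≤ F * (7 * V + 13) := Nat.mul_le_mul_left F (by omega)
      rw [show (F + 1) * (7 * V + 13) + 1 = (7 * V + 11) + 2 + (F * (7 * V + 13) + 1) by ring]
      omega

/-- With value `0` nothing happens any more. [folklore] -/
theorem logC_zero : ∀ (F D : ℕ), logC F (0, D) = (0, D)
  | 0, _ => rfl
  | F + 1, D => by rw [logC, show logStepC (0, D) = (0, D) by simp [logStepC], logC_zero F D]

/-- **Arithmetic of the logarithm loop**: with fuel `F ≥ V`, the count gains exactly `⌊log₂ V⌋`.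
[folklore] -/
theorem logC_snd : ∀ (F V D : ℕ), V ≤ F → (logC F (V, D)).2 = D + Nat.log 2 V
  | 0, V, D, h => by
    have hV : V = 0 := by omega
    subst hV; simp [logC]
  | F + 1, V, D, h => by
    rw [logC]
    by_cases hV : 2 ≤ V
    · have hstep : logStepC (V, D) = (V / 2, D + 1) := by simp [logStepC, hV]
      rw [hstep, logC_snd F (V / 2) (D + 1) (by omega), Nat.log_div_base]
      have := Nat.log_pos (b := 2) (by norm_num) hV
      omega
    · have hstep : logStepC (V, D) = (0, D) := by
        simp [logStepC, hV]; omega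
      rw [hstep, logC_zero, Nat.log_of_lt (by omega)]
      simp

/-- The value register after the loop: `⌊V / 2^F⌋`-like residue, here only its vanishing for
`F ≥ V` is recorded. [folklore] -/
theorem logC_fst : ∀ (F V D : ℕ), V ≤ F → (logC F (V, D)).1 = 0
  | 0, V, D, h => by
    have hV : V = 0 := by omega
    subst hV; simp [logC]
  | F + 1, V, D, h => by
    rw [logC]
    by_cases hV : 2 ≤ V
    · have hstep : logStepC (V, D) = (V / 2, D + 1) := by simp [logStepC, hV]
      rw [hstep, logC_fst F (V / 2) (D + 1) (by omega)]
    · have hstep : logStepC (V, D) = (0, D) := by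
        simp [logStepC, hV]; omega
      rw [hstep, logC_zero]

end Generic

end Com

end Literature.Computability.Complexity
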